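import Summits.ResolutionOfSingularities.ResolutionOfSingularities.Theorems.HomologicalConductorNoZenoThreadStep
import HarnessLib

/-!
# Crux `NoZenoR` / `NoZeno` (stmt-ResolutionOfSingularities-19943 / -16483), β layer:
# T-GERM — the thread germs `D_m = (T_m)_(P_m) ⊆ K` are normal surface germs with isolated singularity,
# and `I_m = ca(T_m)·D_m` is `𝔪`-primary inside them

Route `ResolutionOfSingularities/HomologicalConductor`.  OURS (cell res-hironaka, chain W4.4); nothing here is a
statement of the manuscript under review, and nothing here asserts a Theses declaration.  Third file of the
thread dictionary (`…NoZenoThreadLocalisation` = T-SURF p518180, `…NoZenoThreadStep` = BRIDGE + T-STEP p519967):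
the conclusions of T-SURF, which live on the abstract `Localization.AtPrime P`, are transferred along the BRIDGE
to the explicit germ `D := Parasite.locPrime T P ⊆ K` of a singular prime thread at a normalised stage
`T = tower O A (n + 1)` of Krull dimension `3`, so that the binders of the β2(n = 3) surface form (CHAIN W4.4 v12
§3.3) are literal tree facts about `D` and the ideal `I := ca(T)·D = Ideal.span {d ∈ D | d ∈ ca(T)}`:

* `radical_map_eq_maximalIdeal_of_mem_minimalPrimes'`, `isPrimary_map_of_mem_minimalPrimes'` — T-SURF (T3) for
  ANY localisation `S` of `T` at `P` (`IsLocalization.AtPrime S P`, `S` local), not just `Localization.AtPrime P`;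
* `map_cohomologyAnnihilator_locPrime_eq_span` — `ca(T)·D` is the span of the elements of `D` lying in the
  route's `ca (tower O A (n+1)) ⊆ K`;
* `map_caIdeal_locPrime_eq_span` — the same ideal as the extension of `Parasite.caIdeal O A m`;
* **`threadGerm`** — under the hypotheses a `Parasite.SingularPrimeThread` hands over at stage `n + 1`
  (`P` prime containing the `ca`-elements, some `s` of `O`-value `< 1` outside `P`, `dim T = 3`):
  `dim D = 2`, `D` integrally closed, `D` NOT regular, `D` an isolated singularity, `√I = 𝔪_D`, `I` primary,
  `I ≤ ca(D)`; `threadGerm_map` — the three ideal conjuncts in the `Ideal.map (inclusion) (cohomologyAnnihilator T)`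
  vocabulary of T-SURF.  NOT claimed: `I = ca(D)`.

References: S. Iyengar, R. Takahashi, IMRN 2016, Lemma 2.10 (1) / Thm. 5.4 [`IyengarTakahashi2014`];
M. Atiyah, I. Macdonald (1969), Prop. 3.11, Prop. 4.8–4.9 (primary ideals under localisation) [`AtiyahMacdonald1969`].
-/

noncomputable section

-- single-problem summit: the doubled namespace component `ResolutionOfSingularities` is forced
set_option linter.dupNamespace false

namespace Summit.ResolutionOfSingularities.ResolutionOfSingularities.Theorems.NoZeno.SandwichCluster.Thread

open IsLocalRing
open Summit.ResolutionOfSingularities.ResolutionOfSingularities.Theses.HomologicalConductor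
open Summit.ResolutionOfSingularities.ResolutionOfSingularities.Theorems.NoZeno.Birth
open Parasite (locPrime mem_locPrime_of_mem inv_mem_locPrime_of_not_mem)
open Literature.RingTheory.CohomologyAnnihilator (cohomologyAnnihilator IsIsolatedSingularity
  map_cohomologyAnnihilator_le_of_isLocalization isIsolatedSingularity_of_isIntegrallyClosed_of_ringKrullDim_le_two)

/-! ## T-SURF (T3) for an arbitrary localisation at `P` -/

section General

variable {R : Type*} [CommRing R] (S : Type*) [CommRing S] [Algebra R S] [IsLocalRing S]

/-- **(T3, radical; any localisation at `P`)** If `P` is a minimal prime of `J` and `S` is a localisation of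
`R` at `P` (a local ring), then `√(J·S) = 𝔪_S`. [cite: AtiyahMacdonald1969, Prop. 4.8] [folklore] -/
theorem radical_map_eq_maximalIdeal_of_mem_minimalPrimes' {J P : Ideal R} [P.IsPrime]
    [IsLocalization.AtPrime S P] (hP : P ∈ J.minimalPrimes) :
    (J.map (algebraMap R S)).radical = maximalIdeal S := by
  -- adapted from `radical_map_eq_maximalIdeal_of_mem_minimalPrimes` (T-SURF, `Localization.AtPrime`)
  apply le_antisymm
  · have h1 : J.map (algebraMap R S) ≤ maximalIdeal S := by
      rw [← IsLocalization.AtPrime.map_eq_maximalIdeal P S]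
      exact Ideal.map_mono hP.1.2
    calc (J.map (algebraMap R S)).radical ≤ (maximalIdeal S).radical := Ideal.radical_mono h1
      _ = maximalIdeal S := Ideal.IsPrime.radical inferInstance
  · rw [Ideal.radical_eq_sInf]
    refine le_sInf fun 𝔔 h𝔔 => ?_
    obtain ⟨hJ𝔔, h𝔔prime⟩ := h𝔔
    have hJQ : J ≤ 𝔔.comap (algebraMap R S) := Ideal.map_le_iff_le_comap.mp hJ𝔔
    have hQP : 𝔔.comap (algebraMap R S) ≤ P := by
      intro x hx
      by_contra hxP
      have hu : IsUnit (algebraMap R S x) :=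
        IsLocalization.map_units (M := P.primeCompl) S ⟨x, show x ∈ P.primeCompl from hxP⟩
      exact h𝔔prime.ne_top (Ideal.eq_top_of_isUnit_mem _ (Ideal.mem_comap.mp hx) hu)
    have hPQ : P ≤ 𝔔.comap (algebraMap R S) := hP.2 ⟨Ideal.comap_isPrime _ 𝔔, hJQ⟩ hQP
    calc maximalIdeal S = P.map (algebraMap R S) := (IsLocalization.AtPrime.map_eq_maximalIdeal P S).symm
      _ ≤ (𝔔.comap (algebraMap R S)).map (algebraMap R S) := Ideal.map_mono hPQ
      _ ≤ 𝔔 := Ideal.map_comap_le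

/-- **(T3, primary; any localisation at `P`)** … hence `J·S` is `𝔪_S`-primary. [cite: AtiyahMacdonald1969,
Prop. 4.9] [folklore] -/
theorem isPrimary_map_of_mem_minimalPrimes' {J P : Ideal R} [P.IsPrime] [IsLocalization.AtPrime S P]
    (hP : P ∈ J.minimalPrimes) : (J.map (algebraMap R S)).IsPrimary :=
  Ideal.isPrimary_of_isMaximal_radical
    (by rw [radical_map_eq_maximalIdeal_of_mem_minimalPrimes' S hP]; exact maximalIdeal.isMaximal S)

end General

/-! ## The germs of a singular prime thread -/

section Germ

variable {k K : Type} [Field k] [Field K] [Algebra k K]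

/-- For a stage subalgebra `T` and a prime `P`, with the inclusion algebra structure `T → D := locPrime T P`:
**`ca(T)·D` is the span of the elements of `D` lying in the route's `ca T ⊆ K`.** [this work] -/
theorem map_cohomologyAnnihilator_locPrime_eq_span (T : Subalgebra k K) (P : Ideal ↥T) (hP : P.IsPrime) :
    @Ideal.map ↥T ↥(locPrime T P hP) (↥T →+* ↥(locPrime T P hP)) _ _ _
        (Subring.inclusion (toSubring_le_locPrime T P hP)) (cohomologyAnnihilator ↥T) =
      Ideal.span {d : ↥(locPrime T P hP) | (d : K) ∈ ca T} := by
  unfold Ideal.map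
  congr 1
  ext d
  constructor
  · rintro ⟨c, hc, rfl⟩
    exact (tn_coe_mem_ca_iff T c).mpr hc
  · intro hd
    have hdT : (d : K) ∈ T := ca_subset T hd
    refine ⟨⟨(d : K), hdT⟩, (tn_coe_mem_ca_iff T ⟨(d : K), hdT⟩).mp hd, Subtype.ext rfl⟩

/-- The same ideal from the `Parasite` centre ideal `caIdeal O A m = ca(T_m)·T_m`: its extension to the germ
`D = locPrime T_m P` is the span of the elements of `D` lying in `ca T_m`. [this work] -/
theorem map_caIdeal_locPrime_eq_span (O : ValuationSubring K) (A : Subalgebra k K) (m : ℕ)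
    (P : Ideal ↥(tower O A m)) (hP : P.IsPrime) :
    @Ideal.map ↥(tower O A m) ↥(locPrime (tower O A m) P hP) (↥(tower O A m) →+* ↥(locPrime (tower O A m) P hP))
        _ _ _ (Subring.inclusion (toSubring_le_locPrime (tower O A m) P hP)) (Parasite.caIdeal O A m) =
      Ideal.span {d : ↥(locPrime (tower O A m) P hP) | (d : K) ∈ ca (tower O A m)} := by
  rw [← map_cohomologyAnnihilator_locPrime_eq_span]
  congr 1
  apply le_antisymm
  · exact (caIdeal_le_iff O A m _).mpr le_rfl
  · intro c hc
    exact Ideal.subset_span ((tn_coe_mem_ca_iff (tower O A m) c).mpr hc)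

/-- **T-GERM.** Let `T = T_(n+1)` be a normalised stage of Krull dimension `3`, `P` a prime of `T` containing every
element of `T` lying in `ca (tower O A (n+1))`, and `s ∈ T` of `O`-value `< 1` outside `P` (the binders a
`Parasite.SingularPrimeThread` hands over).  Put `D := Parasite.locPrime T P` (a subring of `K`, local by
`Parasite.isLocalRing_locPrime`) and `I := Ideal.span {d ∈ D | d ∈ ca T} = ca(T)·D`.  Then
`dim D = 2`, `D` is integrally closed, `D` is NOT regular, `D` is an isolated singularity, `√I = 𝔪_D`, `I` is
primary, and `I ≤ ca(D)`.  (T-SURF `threadLocalisation_of_thread` transported along the BRIDGE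
`isLocalization_locPrime` / `exists_ringEquiv_locPrime`.)  NOT claimed: `I = ca(D)`. [this work] -/
theorem threadGerm (O : ValuationSubring K) (A : Subalgebra k K)
    (hk : ∀ c : k, algebraMap k K c ∈ O) (hA : A.FG) (hfr : IsFractionRing ↥A K)
    (hAO : A.toSubring ≤ O.toSubring) (n : ℕ) (hdim : ringKrullDim ↥(tower O A (n + 1)) = 3)
    (P : Ideal ↥(tower O A (n + 1))) (hP : P.IsPrime)
    (hca : ∀ (x : K) (hx : x ∈ tower O A (n + 1)), x ∈ ca (tower O A (n + 1)) →
      (⟨x, hx⟩ : ↥(tower O A (n + 1))) ∈ P)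
    (hs : ∃ (s : K) (hs : s ∈ tower O A (n + 1)), O.valuation s < 1 ∧
      (⟨s, hs⟩ : ↥(tower O A (n + 1))) ∉ P) :
    ringKrullDim ↥(locPrime (tower O A (n + 1)) P hP) = 2 ∧
      IsIntegrallyClosed ↥(locPrime (tower O A (n + 1)) P hP) ∧
      ¬ IsRegularLocalRing ↥(locPrime (tower O A (n + 1)) P hP) ∧
      @IsIsolatedSingularity ↥(locPrime (tower O A (n + 1)) P hP) _
        (Parasite.isLocalRing_locPrime (tower O A (n + 1)) P hP) ∧
      (Ideal.span {d : ↥(locPrime (tower O A (n + 1)) P hP) | (d : K) ∈ ca (tower O A (n + 1))}).radical =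
        @maximalIdeal ↥(locPrime (tower O A (n + 1)) P hP) _
          (Parasite.isLocalRing_locPrime (tower O A (n + 1)) P hP) ∧
      (Ideal.span {d : ↥(locPrime (tower O A (n + 1)) P hP) | (d : K) ∈ ca (tower O A (n + 1))}).IsPrimary ∧
      Ideal.span {d : ↥(locPrime (tower O A (n + 1)) P hP) | (d : K) ∈ ca (tower O A (n + 1))} ≤
        cohomologyAnnihilator ↥(locPrime (tower O A (n + 1)) P hP) := by
  haveI := hP
  haveI := hfr
  -- T-SURF on the abstract localisation
  obtain ⟨hht, -, -, hsing, hmin, -, -, -, -⟩ :=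
    threadLocalisation_of_thread O A hk hA hfr hAO n hdim P hca hs
  -- the stage: normal, Noetherian
  haveI : IsIntegrallyClosed ↥(tower O A (n + 1)) := d2rc_isIntegrallyClosed_tower_succ O A hk hA hfr hAO n
  haveI : IsNoetherianRing ↥(tower O A (n + 1)) := stub_towerNoetherian k K O A hk hA hfr hAO (n + 1)
  -- the germ as a localisation
  letI alg : Algebra ↥(tower O A (n + 1)) ↥(locPrime (tower O A (n + 1)) P hP) :=
    (Subring.inclusion (toSubring_le_locPrime (tower O A (n + 1)) P hP)).toAlgebra
  haveI hloc := isLocalization_locPrime (tower O A (n + 1)) P hP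
  haveI : IsLocalRing ↥(locPrime (tower O A (n + 1)) P hP) := Parasite.isLocalRing_locPrime _ _ _
  haveI : IsNoetherianRing ↥(locPrime (tower O A (n + 1)) P hP) :=
    IsLocalization.isNoetherianRing P.primeCompl _ inferInstance
  have hIC : IsIntegrallyClosed ↥(locPrime (tower O A (n + 1)) P hP) :=
    isIntegrallyClosed_locPrime (tower O A (n + 1)) P hP
  haveI := hIC
  have hdimD : ringKrullDim ↥(locPrime (tower O A (n + 1)) P hP) = 2 := by
    rw [ringKrullDim_locPrime (tower O A (n + 1)) P hP, hht]; rfl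
  have hspan := map_cohomologyAnnihilator_locPrime_eq_span (tower O A (n + 1)) P hP
  refine ⟨hdimD, hIC, fun h => hsing ((isRegularLocalRing_locPrime_iff (tower O A (n + 1)) P hP).mp h),
    isIsolatedSingularity_of_isIntegrallyClosed_of_ringKrullDim_le_two hdimD.le, ?_, ?_, ?_⟩
  · rw [← hspan]
    exact radical_map_eq_maximalIdeal_of_mem_minimalPrimes' _ hmin
  · rw [← hspan]
    exact isPrimary_map_of_mem_minimalPrimes' _ hmin
  · rw [← hspan]
    exact map_cohomologyAnnihilator_le_of_isLocalization P.primeCompl _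

/-- **T-GERM, `Ideal.map` vocabulary** (the form T-SURF uses on `Localization.AtPrime P`): with the inclusion
`ι : T_(n+1) → D`, `I := (cohomologyAnnihilator T_(n+1)).map ι` satisfies `√I = 𝔪_D`, `I` primary, `I ≤ ca(D)`;
and `I = (Parasite.caIdeal O A (n+1)).map ι = Ideal.span {d ∈ D | d ∈ ca T_(n+1)}`
(`map_cohomologyAnnihilator_locPrime_eq_span`, `map_caIdeal_locPrime_eq_span`). [this work] -/
theorem threadGerm_map (O : ValuationSubring K) (A : Subalgebra k K)
    (hk : ∀ c : k, algebraMap k K c ∈ O) (hA : A.FG) (hfr : IsFractionRing ↥A K)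
    (hAO : A.toSubring ≤ O.toSubring) (n : ℕ) (hdim : ringKrullDim ↥(tower O A (n + 1)) = 3)
    (P : Ideal ↥(tower O A (n + 1))) (hP : P.IsPrime)
    (hca : ∀ (x : K) (hx : x ∈ tower O A (n + 1)), x ∈ ca (tower O A (n + 1)) →
      (⟨x, hx⟩ : ↥(tower O A (n + 1))) ∈ P)
    (hs : ∃ (s : K) (hs : s ∈ tower O A (n + 1)), O.valuation s < 1 ∧
      (⟨s, hs⟩ : ↥(tower O A (n + 1))) ∉ P) :
    (@Ideal.map ↥(tower O A (n + 1)) ↥(locPrime (tower O A (n + 1)) P hP)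
        (↥(tower O A (n + 1)) →+* ↥(locPrime (tower O A (n + 1)) P hP)) _ _ _
        (Subring.inclusion (toSubring_le_locPrime (tower O A (n + 1)) P hP))
        (cohomologyAnnihilator ↥(tower O A (n + 1)))).radical =
        @maximalIdeal ↥(locPrime (tower O A (n + 1)) P hP) _
          (Parasite.isLocalRing_locPrime (tower O A (n + 1)) P hP) ∧
      (@Ideal.map ↥(tower O A (n + 1)) ↥(locPrime (tower O A (n + 1)) P hP)
        (↥(tower O A (n + 1)) →+* ↥(locPrime (tower O A (n + 1)) P hP)) _ _ _
        (Subring.inclusion (toSubring_le_locPrime (tower O A (n + 1)) P hP))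
        (cohomologyAnnihilator ↥(tower O A (n + 1)))).IsPrimary ∧
      @Ideal.map ↥(tower O A (n + 1)) ↥(locPrime (tower O A (n + 1)) P hP)
        (↥(tower O A (n + 1)) →+* ↥(locPrime (tower O A (n + 1)) P hP)) _ _ _
        (Subring.inclusion (toSubring_le_locPrime (tower O A (n + 1)) P hP))
        (cohomologyAnnihilator ↥(tower O A (n + 1))) ≤
        cohomologyAnnihilator ↥(locPrime (tower O A (n + 1)) P hP) := by
  obtain ⟨-, -, -, -, h1, h2, h3⟩ := threadGerm O A hk hA hfr hAO n hdim P hP hca hs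
  rw [← map_cohomologyAnnihilator_locPrime_eq_span] at h1 h2 h3
  exact ⟨h1, h2, h3⟩

/-- **The honest gap, quantified: `ca(D)` is `𝔪_D`-primary too, so `I = ca(T)·D ≤ ca(D)` are two `𝔪_D`-primary
ideals with the same radical.**  For the thread germ `D = (T_(n+1))_P` (binders as in `threadGerm`):
`√(ca D) = 𝔪_D` and `ca D ≠ ⊤` — `D` is essentially of finite type over `k` (a localisation of the stage), singular,
and an isolated singularity, so by Iyengar–Takahashi 5.4 the only prime containing `ca(D)` is `𝔪_D`.  (The equality
`I = ca(D)` is NOT claimed: `caSheaf_false`.) [cite: IyengarTakahashi2014, Thm. 5.4] -/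
theorem radical_cohomologyAnnihilator_threadGerm (O : ValuationSubring K) (A : Subalgebra k K)
    (hk : ∀ c : k, algebraMap k K c ∈ O) (hA : A.FG) (hfr : IsFractionRing ↥A K)
    (hAO : A.toSubring ≤ O.toSubring) (n : ℕ) (hdim : ringKrullDim ↥(tower O A (n + 1)) = 3)
    (P : Ideal ↥(tower O A (n + 1))) (hP : P.IsPrime)
    (hca : ∀ (x : K) (hx : x ∈ tower O A (n + 1)), x ∈ ca (tower O A (n + 1)) →
      (⟨x, hx⟩ : ↥(tower O A (n + 1))) ∈ P)
    (hs : ∃ (s : K) (hs : s ∈ tower O A (n + 1)), O.valuation s < 1 ∧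
      (⟨s, hs⟩ : ↥(tower O A (n + 1))) ∉ P) :
    (cohomologyAnnihilator ↥(locPrime (tower O A (n + 1)) P hP)).radical =
        @maximalIdeal ↥(locPrime (tower O A (n + 1)) P hP) _
          (Parasite.isLocalRing_locPrime (tower O A (n + 1)) P hP) ∧
      cohomologyAnnihilator ↥(locPrime (tower O A (n + 1)) P hP) ≠ ⊤ := by
  haveI := hP
  haveI := hfr
  obtain ⟨-, -, hsing, hiso, -⟩ := threadGerm O A hk hA hfr hAO n hdim P hP hca hs
  -- the germ is essentially of finite type over `k`: a localisation of the stage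
  obtain ⟨-, -, hET⟩ := tn_tower_invariant O A hk hA hfr hAO (n + 1)
  haveI := hET
  letI algTD : Algebra ↥(tower O A (n + 1)) ↥(locPrime (tower O A (n + 1)) P hP) :=
    (Subring.inclusion (toSubring_le_locPrime (tower O A (n + 1)) P hP)).toAlgebra
  haveI := isLocalization_locPrime (tower O A (n + 1)) P hP
  letI algkD : Algebra k ↥(locPrime (tower O A (n + 1)) P hP) :=
    ((algebraMap ↥(tower O A (n + 1)) ↥(locPrime (tower O A (n + 1)) P hP)).comp
      (algebraMap k ↥(tower O A (n + 1)))).toAlgebra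
  haveI : IsScalarTower k ↥(tower O A (n + 1)) ↥(locPrime (tower O A (n + 1)) P hP) :=
    IsScalarTower.of_algebraMap_eq fun _ => rfl
  haveI : Algebra.EssFiniteType ↥(tower O A (n + 1)) ↥(locPrime (tower O A (n + 1)) P hP) :=
    Algebra.EssFiniteType.of_isLocalization _ P.primeCompl
  haveI : Algebra.EssFiniteType k ↥(locPrime (tower O A (n + 1)) P hP) :=
    Algebra.EssFiniteType.comp k ↥(tower O A (n + 1)) _
  haveI : IsLocalRing ↥(locPrime (tower O A (n + 1)) P hP) := Parasite.isLocalRing_locPrime _ _ _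
  -- Iyengar–Takahashi 5.4 on `D`
  have hIT := fun (Q : Ideal ↥(locPrime (tower O A (n + 1)) P hP)) [Q.IsPrime] =>
    cohomologyAnnihilator_le_iff_not_isRegularLocalRing k ↥(locPrime (tower O A (n + 1)) P hP) Q
  have hcam : cohomologyAnnihilator ↥(locPrime (tower O A (n + 1)) P hP) ≤ maximalIdeal _ :=
    (hIT (maximalIdeal _)).mpr
      (fun h => hsing ((SandwichCluster.isRegularLocalRing_atPrime_maximalIdeal_iff _).mp h))
  refine ⟨le_antisymm ?_ ?_, fun h => (maximalIdeal.isMaximal _).ne_top (top_le_iff.mp (h ▸ hcam))⟩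
  · calc (cohomologyAnnihilator ↥(locPrime (tower O A (n + 1)) P hP)).radical
        ≤ (maximalIdeal _).radical := Ideal.radical_mono hcam
      _ = maximalIdeal _ := Ideal.IsPrime.radical inferInstance
  · rw [Ideal.radical_eq_sInf]
    refine le_sInf fun Q hQ => ?_
    obtain ⟨hcaQ, hQprime⟩ := hQ
    by_cases hQm : Q = maximalIdeal _
    · exact hQm ▸ le_rfl
    · exact absurd (hiso Q hQm) ((hIT Q).mp hcaQ)

end Germ

end Summit.ResolutionOfSingularities.ResolutionOfSingularities.Theorems.NoZeno.SandwichCluster.Thread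

end
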